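import Mathlib
import HarnessLib

/-!
# Route FeketeScales — crux `SparseGoodScales` (stmt-ABC-2161): the function-field shadow of the
# Wieferich floor — in `F[X]`, Wieferich congruences are killed by `d/dX`

Helper file (`--supports stmt-ABC-2161`) for the crux `SparseGoodScales` of route `FeketeScales`
(round-2 ideator 5's package `Cruxes/SparseGoodScales/SketchIdeator5r2.lean`, `BarrierNotes-r2-k5.md`
R1(v)): the calibration of the crux's kernel-checked WIEFERICH FLOOR
(`Theorems/FeketeScalesSparseGoodScalesWieferich.lean`, p99695:
`SparseGoodScales → ∀ q prime, {p prime | ¬ IsWieferich q p}.Infinite`, open over `ℤ` in every base —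
Ribenboim 2004, Ch. 5 §III, problem (2)).  Over `F[X]` the same congruence is decided by one
differentiation: if `P` is prime, `P ∤ a`, `(m : F) = −1` and `P² ∣ a^m − 1` then `P ∣ a′`
(`prime_dvd_derivative_of_sq_dvd_pow_sub_one`); with `F` finite of characteristic `p` and
`m = |F|^{deg P} − 1` (`cast_pow_sub_one_eq_neg_one`) this says that the Wieferich primes of a
separable base `a` all divide `a′` (finitely many), while for an inseparable base every prime is
Wieferich.  This is the precise sense in which `Literature.Barriers.ABC.NoArithmeticDerivative` bites
THIS crux: any line for stmt-ABC-2161 must supply over `ℤ` what `F[X]` gets from `d/dX` already at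
the level of Wieferich, before any abc content is reached.  Pure polynomial algebra; no definitions.
-/

-- `Summit.<Summit>.<Problem>` is the mandated summit-side namespace (CONVENTIONS §2); for the
-- single-conjunct summit `ABC` the two coincide, so the duplicate `ABC.ABC` is deliberate.
set_option linter.dupNamespace false

namespace Summit.ABC.ABC.Theorems.SparseGoodScales

open Polynomial

/-- **Wieferich congruences in `F[X]` are killed by `d/dX`.**  If `P` is prime, `P ∤ a`,
`(m : F) = −1` and `P² ∣ a^m − 1`, then `P ∣ a′`.  (Differentiate `a^m − 1 = P²M`:
`m·a^{m−1}·a′ = 2PP′M + P²M′`, and `m = −1` in `F`.)  With `F` finite of characteristic `p` and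
`m = |F|^{deg P} − 1` this says: the Wieferich primes to a base `a` with `a′ ≠ 0` all divide
`a′` — finitely many; for an inseparable base (`a′ = 0`, `a` a `p`-th power) every prime is
Wieferich.  The integer analogue for the base `2` — infinitely many `p` with `2^{p−1} ≢ 1 (p²)` —
is open (Ribenboim 2004, Ch. 5 §III (2)) and is implied by the crux (p99695). [folklore] -/
theorem prime_dvd_derivative_of_sq_dvd_pow_sub_one {F : Type*} [Field F] {P a : F[X]} {m : ℕ}
    (hP : Prime P) (hPa : ¬ P ∣ a) (hm : ((m : ℕ) : F) = -1) (h : P ^ 2 ∣ a ^ m - 1) :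
    P ∣ derivative a := by
  obtain ⟨M, hM⟩ := h
  have hd : derivative (a ^ m - 1) = derivative (P ^ 2 * M) := by rw [hM]
  rw [derivative_sub, derivative_one, sub_zero, derivative_pow, derivative_mul,
    derivative_pow] at hd
  have h21 : (2 - 1 : ℕ) = 1 := rfl
  rw [h21, pow_one] at hd
  have hdvd : P ∣ C (m : F) * a ^ (m - 1) * derivative a := by
    rw [hd]
    refine dvd_add ?_ ?_
    · exact dvd_mul_of_dvd_left (dvd_mul_of_dvd_left (dvd_mul_left P _) _) _
    · exact dvd_mul_of_dvd_left (dvd_pow_self P two_ne_zero) _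
  rw [hm, map_neg, map_one, neg_one_mul, neg_mul, dvd_neg] at hdvd
  rcases hP.dvd_or_dvd hdvd with h1 | h2
  · exact absurd (hP.dvd_of_dvd_pow h1) hPa
  · exact h2

/-- In characteristic `p`, `m = p^k − 1` (`k ≥ 1`) satisfies `(m : F) = −1`; with
`p^k = |F|^{deg P}` this is the exponent of the Wieferich congruence in `F[X]`. [folklore] -/
theorem cast_pow_sub_one_eq_neg_one (F : Type*) [Field F] (p : ℕ) [CharP F p] {k : ℕ}
    (hk : k ≠ 0) (hp : 1 ≤ p) : ((p ^ k - 1 : ℕ) : F) = -1 := by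
  have h1 : 1 ≤ p ^ k := Nat.one_le_pow k p hp
  rw [Nat.cast_sub h1, Nat.cast_pow, CharP.cast_eq_zero F p, zero_pow hk, Nat.cast_one,
    zero_sub]

/-- **Function-field Wieferich floor, registered form** (the sub-goal of stmt-ABC-2161 this file
serves, on one line: it is the signature registered on the item): in `F[X]`, a prime `P ∤ a` with
`P² ∣ a^m − 1`, `(m : F) = −1`, divides `a′`.  This is `prime_dvd_derivative_of_sq_dvd_pow_sub_one`.
[folklore] -/
theorem sparseGoodScales_functionField_wieferich_dvd_derivative : ∀ (F : Type) [Field F] (P a : Polynomial F) (m : ℕ), Prime P → ¬ P ∣ a → ((m : ℕ) : F) = -1 → P ^ 2 ∣ a ^ m - 1 → P ∣ Polynomial.derivative a :=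
  fun _F _ _P _a _m hP hPa hm h => prime_dvd_derivative_of_sq_dvd_pow_sub_one hP hPa hm h

end Summit.ABC.ABC.Theorems.SparseGoodScales
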